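import Summits.CriticalPhenomena.PercolationContinuityZ3.Theorems.Transplant.FKDoubleFanWordCells
import Summits.CriticalPhenomena.PercolationContinuityZ3.Theorems.Transplant.FKDoubleFanOneSidedConeABS
import HarnessLib

/-!
# Double fans `K₂ ∨ P_{m+1}`, cells of a fixed middle pattern: PEELING the first / last block at the trivial product vector `𝟙`,
# and the `t`-EXPANSION of the roof cells

Helper file (`--supports stmt-CriticalPhenomena-4575`), FK sub-lane `prim-bschramm-fk-3` (gen 48); builds on p205010 (kernel theorem, internal
audit signed; external expert review pending).  Pure real algebra; no named facts, no sorries; standard axioms.  Memo `bschramm/prim-bschramm-fk-3/FAR-CROSS-XXIII.md` §0(D)(E).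

Two structural identities for the 36 cells `cellFn q mids rd P S` of `…WordCells` (`P, S ∈ IsEndP`):
* PEELING AT `𝟙`.  The trivial product vector `𝟙 = uprods δ_0` has an input bivector that is an EIGENVECTOR of every rim step,
  `∧²E_r (δ_0 ∧ P_a δ_0) = r(r + (1−r)q)·(δ_0 ∧ P_a δ_0)` (**`opE_inputBiv_rayOne`**), and the spokes of the first middle vertex then act on `δ_0` itself;
  hence (**`cellFn_cons_rayOne`**) `cellFn q ((r,x,y)::rest) rd 𝟙 S = r(r+(1−r)q) · cellFn q rest rd (uprods (AC_x ∗ BC_y ∗ δ_0)) S` — the `(𝟙, S)`-cells of a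
  pattern are `ρr` times cells of the SHORTER pattern at the honest input `AC_x BC_y δ_0 ∈ InKE`.  Mirror version at the target end (**`opE_targetBiv_rayOne`**, `opAC_opBC` of `…OneSidedConeABS`,
  **`opBlocks_append`**, **`cellFn_snoc_rayOne`**): `cellFn q (mids ++ [(r,x,y)]) rd P 𝟙 = rd(rd+(1−rd)q) · cellFn q mids r P (sprods (AC_x ∗ BC_y ∗ δ_0))`.
  (These are the `One–roof` / `roof–One` cells, which are NOT tensor-Bernstein certifiable, memo §0(B).)
* `t`-EXPANSION OF A ROOF LEG.  `roofP q t w = roofR0 q w + t·roofR1 q w + t²(2−q)·𝟙` (**`roofP_eq_expansion`**; `roofR0 = 2w(1−w)·V₀ + xw·A + zw·D`,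
  `roofR1 = 2w(1−w)·𝟙 + (2−q)·V₀ + xw·AC + zw·BD`, `V₀ = e_uv + e_xv + e_zv`), so by bilinearity (**`cellFn_roof_left`**, **`cellFn_roof_right`**) a roof cell is a
  quadratic in the roof ratio `t ≥ 0` whose `t²`-coefficient is a `𝟙`-cell, and (**`cellFn_roof_left_nonneg`**, **`cellFn_roof_right_nonneg`**) it is `≥ 0` as soon
  as its three `t`-coefficients are — the form in which the ray–roof cells of the distance-3 patterns are certified (memo §0(E): all three parts are `≥ 0` there;
  for roof–roof the mixed parts are not, memo §0(F)).
[folklore]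
-/

noncomputable section

namespace Summit.CriticalPhenomena.PercolationContinuityZ3.Theorems

namespace FK

namespace ThreeApex

/-! ### Peeling the first block at `𝟙` -/

/-- `𝟙` is the product vector of `δ_0`. [folklore] -/
theorem uprods_delta0 : uprods delta0 = rayOne := by
  ext <;> simp [uprods, delta0, rayOne, hx, hy, hz, V5.total]

/-- `𝟙` is also the target product vector of `δ_0`. [folklore] -/
theorem sprods_delta0 : sprods delta0 = rayOne := by
  ext <;> simp [sprods, delta0, rayOne, hx, hy, hz, V5.total]

/-- **The input bivector of `δ_0` is an eigenvector of every rim step**: `∧²E_r (inputBiv 𝟙) = r(r+(1−r)q) · inputBiv 𝟙`. [folklore] -/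
theorem opE_inputBiv_rayOne (q r : ℝ) : opE q r (inputBiv rayOne) = Biv.smul (r * (r + (1 - r) * q)) (inputBiv rayOne) := by
  ext <;> simp only [opE, opTD, opWD, formD, Biv.lin3, Biv.add, Biv.smul, inputBiv, rayOne] <;> ring

/-- The spokes of the first middle vertex act on `δ_0` itself: `∧²AC_x ∧²BC_y (inputBiv 𝟙) = inputBiv (uprods (AC_x ∗ BC_y ∗ δ_0))`. [folklore] -/
theorem opAC_opBC_inputBiv_rayOne (x y : ℝ) :
    opAC x (opBC y (inputBiv rayOne)) = inputBiv (uprods (conv (edgeAC x) (conv (edgeBC y) delta0))) := by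
  ext <;> simp only [opAC, opBC, opTa, opWa, opTb, opWb, Biv.lin3, Biv.add, Biv.smul, inputBiv, rayOne, uprods, conv, edgeAC, edgeBC,
    delta0, hx, hy, hz, V5.total] <;> ring

/-- **Peeling the first block at `𝟙`**: `cellFn q ((r,x,y)::rest) rd 𝟙 S = r(r+(1−r)q) · cellFn q rest rd (uprods (AC_x ∗ BC_y ∗ δ_0)) S`. [folklore] -/
theorem cellFn_cons_rayOne (q : ℝ) (blk : ℝ × ℝ × ℝ) (rest : List (ℝ × ℝ × ℝ)) (rd : ℝ) (S : P6) :
    cellFn q (blk :: rest) rd rayOne S =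
      blk.1 * (blk.1 + (1 - blk.1) * q) * cellFn q rest rd (uprods (conv (edgeAC blk.2.1) (conv (edgeBC blk.2.2) delta0))) S := by
  simp only [cellFn, opBlocks, opE_inputBiv_rayOne, opBC_smul', opAC_smul, opBlocks_smul, opE_smul, pairH_smul_left,
    opAC_opBC_inputBiv_rayOne]

/-! ### Peeling the last block at `𝟙` (target end) -/

/-- `opBlocks` of a concatenation. [folklore] -/
theorem opBlocks_append (q : ℝ) : ∀ (m₁ m₂ : List (ℝ × ℝ × ℝ)) (β : Biv), opBlocks q (m₁ ++ m₂) β = opBlocks q m₂ (opBlocks q m₁ β)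
  | [], m₂, β => rfl
  | blk :: rest, m₂, β => by
    simp only [List.cons_append, opBlocks]
    exact opBlocks_append q rest m₂ _

/-- **The target bivector of `δ_0` is an eigenvector of every rim step**: `∧²E_r (targetBiv 𝟙) = r(r+(1−r)q) · targetBiv 𝟙`. [folklore] -/
theorem opE_targetBiv_rayOne (q r : ℝ) : opE q r (targetBiv rayOne) = Biv.smul (r * (r + (1 - r) * q)) (targetBiv rayOne) := by
  ext <;> simp only [opE, opTD, opWD, formD, Biv.lin3, Biv.add, Biv.smul, targetBiv, rayOne] <;> ring

/-- The spokes of the last middle vertex act on the target `δ_0`: `∧²AC_x ∧²BC_y (targetBiv 𝟙) = targetBiv (sprods (AC_x ∗ BC_y ∗ δ_0))`. [folklore] -/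
theorem opAC_opBC_targetBiv_rayOne (x y : ℝ) :
    opAC x (opBC y (targetBiv rayOne)) = targetBiv (sprods (conv (edgeAC x) (conv (edgeBC y) delta0))) := by
  ext <;> simp only [opAC, opBC, opTa, opWa, opTb, opWb, Biv.lin3, Biv.add, Biv.smul, targetBiv, rayOne, sprods, conv, edgeAC, edgeBC,
    delta0, hx, hy, hz, V5.total] <;> ring

/-- **Peeling the last block at `𝟙`**: `cellFn q (mids ++ [(r,x,y)]) rd P 𝟙 = rd(rd+(1−rd)q) · cellFn q mids r P (sprods (AC_x ∗ BC_y ∗ δ_0))`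
(self-adjointness of the three letter operators for `pairH`). [folklore] -/
theorem cellFn_snoc_rayOne (q : ℝ) (mids : List (ℝ × ℝ × ℝ)) (blk : ℝ × ℝ × ℝ) (rd : ℝ) (P : P6) :
    cellFn q (mids ++ [blk]) rd P rayOne =
      rd * (rd + (1 - rd) * q) * cellFn q mids blk.1 P (sprods (conv (edgeAC blk.2.1) (conv (edgeBC blk.2.2) delta0))) := by
  simp only [cellFn, opBlocks_append, opBlocks]
  rw [pairH_opE, opE_targetBiv_rayOne, pairH_comm, pairH_smul_left, pairH_comm, pairH_opAC, pairH_opBC, ← opAC_opBC,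
    opAC_opBC_targetBiv_rayOne]

/-! ### The `t`-expansion of a roof leg -/

/-- The `t⁰`-part of a roof vector: `2w(1−w)·V₀ + xw·A + zw·D` (`V₀ = e_uv + e_xv + e_zv`). [folklore] -/
def roofR0 (q w : ℝ) : P6 :=
  ⟨2 * w * (1 - w), 2 * w * (1 - w) + xwR q w, 0, 0, 2 * w * (1 - w) + zwR q w, 0⟩

/-- The `t¹`-part of a roof vector: `2w(1−w)·𝟙 + (2−q)·V₀ + xw·AC + zw·BD`. [folklore] -/
def roofR1 (q w : ℝ) : P6 :=
  ⟨2 * w * (1 - w) + (2 - q), 2 * w * (1 - w) + xwR q w + (2 - q), 2 * w * (1 - w) + zwR q w, 2 * w * (1 - w) + xwR q w,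
    2 * w * (1 - w) + zwR q w + (2 - q), 2 * w * (1 - w)⟩

/-- **`roofP q t w = roofR0 q w + t·roofR1 q w + t²(2−q)·𝟙`.** [folklore] -/
theorem roofP_eq_expansion (q t w : ℝ) :
    roofP q t w = P6.add (P6.add (roofR0 q w) (P6.smul t (roofR1 q w))) (P6.smul (t ^ 2 * (2 - q)) rayOne) := by
  ext <;> simp only [roofP, roofR0, roofR1, u0R, P6.add, P6.smul, rayOne] <;> ring

section Roof

variable (q : ℝ) (mids : List (ℝ × ℝ × ℝ)) (rd : ℝ)

/-- **`t`-expansion of a roof cell on the input side.** [folklore] -/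
theorem cellFn_roof_left (t w : ℝ) (S : P6) :
    cellFn q mids rd (roofP q t w) S =
      cellFn q mids rd (roofR0 q w) S + t * cellFn q mids rd (roofR1 q w) S + t ^ 2 * (2 - q) * cellFn q mids rd rayOne S := by
  rw [roofP_eq_expansion, cellFn_add_left, cellFn_add_left, cellFn_smul_left, cellFn_smul_left]

/-- **`t`-expansion of a roof cell on the target side.** [folklore] -/
theorem cellFn_roof_right (P : P6) (t w : ℝ) :
    cellFn q mids rd P (roofP q t w) =
      cellFn q mids rd P (roofR0 q w) + t * cellFn q mids rd P (roofR1 q w) + t ^ 2 * (2 - q) * cellFn q mids rd P rayOne := by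
  rw [roofP_eq_expansion, cellFn_add_right, cellFn_add_right, cellFn_smul_right, cellFn_smul_right]

variable {q mids rd}

/-- A roof–`S` cell is `≥ 0` as soon as its three `t`-coefficients are (`t ≥ 0`, `q ≤ 2`). [folklore] -/
theorem cellFn_roof_left_nonneg (hq2 : q ≤ 2) {t w : ℝ} (ht : 0 ≤ t) {S : P6} (h0 : 0 ≤ cellFn q mids rd (roofR0 q w) S)
    (h1 : 0 ≤ cellFn q mids rd (roofR1 q w) S) (h2 : 0 ≤ cellFn q mids rd rayOne S) : 0 ≤ cellFn q mids rd (roofP q t w) S := by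
  rw [cellFn_roof_left]
  have : 0 ≤ t ^ 2 * (2 - q) := mul_nonneg (sq_nonneg t) (by linarith)
  have := mul_nonneg ht h1
  have := mul_nonneg this h2
  nlinarith

/-- A `P`–roof cell is `≥ 0` as soon as its three `t`-coefficients are (`t ≥ 0`, `q ≤ 2`). [folklore] -/
theorem cellFn_roof_right_nonneg (hq2 : q ≤ 2) {P : P6} {t w : ℝ} (ht : 0 ≤ t) (h0 : 0 ≤ cellFn q mids rd P (roofR0 q w))
    (h1 : 0 ≤ cellFn q mids rd P (roofR1 q w)) (h2 : 0 ≤ cellFn q mids rd P rayOne) : 0 ≤ cellFn q mids rd P (roofP q t w) := by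
  rw [cellFn_roof_right]
  have : 0 ≤ t ^ 2 * (2 - q) := mul_nonneg (sq_nonneg t) (by linarith)
  have := mul_nonneg ht h1
  have := mul_nonneg this h2
  nlinarith

end Roof

end ThreeApex

end FK

end Summit.CriticalPhenomena.PercolationContinuityZ3.Theorems
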